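/-
Copyright (c) 2026 the pub-hodgecm-mathlib formalisation cell (harness21).  Prover seat hodgecm-mathlib-K2Liu-p10 (g2), Track B «K2-LIT»,
#184♮ = hLiu418 = `stmt-HodgeConjecture-24832`; LEAD F0P6-plan (g13) RULING «M-157a» (1) 2026-09-04T08:32:14Z: G5-a sub-organ (δ)-0 (the Siegel-height
comparison MW I.2.2 (vii) for `GL_n`, by the product formula) — file 1∕2: the entry lemma.  THEOREMS ONLY (no `def`, no `instance`, no named-fact hypothesis, no `sorry`).
-/
import Summits.Langlands.Langlands.Theorems.IrreducibilityBySelfDualityPairLBoundaryJSGapDecayHeights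
import HarnessLib

/-!
# Crux `HLiu418`, ROAD Φ, (δ)-0 file 1: THE IDELIC NORM OF AN ENTRY IS BOUNDED BY A POWER OF THE ADELIC HEIGHT — `|u|_𝔸 ≤ ‖g‖^{[K:ℚ]}` for
# every idèle `u` occurring as an entry of `g ∈ GL_n(𝔸_K)` (or of `g⁻¹`)

Cell `hodgecm-mathlib`, crux item hLiu418 = `stmt-HodgeConjecture-24832` (helper lane, count-neutral).  The adelic height of ★ `AdelicGLnGlue` is
`‖g‖ = H_∞(g) · ∏ᶠ_v H_v(g)` with `H_∞(g) = max_{ij}(‖(g_∞)_{ij}‖ ⊔ ‖(g_∞⁻¹)_{ij}‖)` (sup norm of `K ⊗ ℝ = ℝ^{r₁} × ℂ^{r₂}`) and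
`H_v(g) = max_{ij}(|g_{ij}|_v ⊔ |(g⁻¹)_{ij}|_v) ≥ 1`; the idelic norm of ★ `IdeleClassGroup.ideleNorm` is `|u|_𝔸 = ∏_w ‖u_w‖^{mult w} · ∏ᶠ_v |u_v|_v`.
Since `Σ_w mult w = [K:ℚ]` (Mathlib `sum_mult_eq`), `‖u_w‖ ≤ H_∞(g)` and `|u_v|_v ≤ H_v(g)` for an entry `u` of `g` (REUSED from the Langlands cell's
`GapDecayHeights.nnnorm_fst_apply_le_archHeight` / `.nnnorm_snd_apply_le_localHeight`, imported — not restated), one gets **`ideleNorm_le_adelicHeightGL_pow_of_entry`: `|u|_𝔸 ≤ ‖g‖^{[K:ℚ]}`** (★ `GLn.one_le_finprod_localHeight` absorbs the finite part into the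
`[K:ℚ]`-th power), and the same for entries of `g⁻¹` (★ `adelicHeightGL_inv`).  This is the lever of the PRODUCT-FORMULA proof of the Siegel-height
comparison (file 2, `K2LiuSiegelHeightComparisonGLn`): a principal idèle times a norm-one idèle times a positive real scalar `ρ(a)` has idelic norm
`a^{[K:ℚ]}` (★ `ideleNorm_principal`), so `a ≤ ‖g‖` whenever such an idèle is an entry of `g`.
Sources: [BorelJacquet1979, §1.2]; [MoeglinWaldspurger1995, I.2.2]; [CasselsFrohlichANT1967, Ch. II §16 (product formula)].
HONEST LABEL.  Helper lemmas, count-neutral; `HC_CM` is proved only modulo the 7 printed citations (2 remaining named inputs: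
hLiu418 = `stmt-HodgeConjecture-24832`, h413 = `stmt-HodgeConjecture-24833`) until rung 0 closes.
-/

set_option autoImplicit false
set_option linter.dupNamespace false -- the mandated namespace repeats `HodgeConjecture.HodgeConjecture`

noncomputable section

namespace Summit.HodgeConjecture.HodgeConjecture.Cruxes.HLiu418.K2LiuIdeleEntryHeightBound

open scoped NNReal MatrixGroups Classical
open NumberField NumberField.InfinitePlace IsDedekindDomain
open Literature.NumberTheory.Automorphic
open Literature.NumberTheory.GaloisRepresentations (ideleGroup)

variable {K : Type} [Field K] [NumberField K] {n : ℕ}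

/-! ## The idelic norm of an entry -/

/-- **`|u|_𝔸 ≤ ‖g‖^{[K:ℚ]}` for an idèle `u` which is an ENTRY of `g ∈ GL_n(𝔸_K)`** (`n ≥ 1`).
[cite: BorelJacquet1979, §1.2] [cite: MoeglinWaldspurger1995, I.2.2] -/
theorem ideleNorm_le_adelicHeightGL_pow_of_entry [NeZero n] (g : GL (Fin n) (AdeleRing (𝓞 K) K)) (i j : Fin n) (u : ideleGroup K)
    (hu : ((g : Matrix (Fin n) (Fin n) (AdeleRing (𝓞 K) K)) i j) = (u : AdeleRing (𝓞 K) K)) :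
    (IdeleClassGroup.ideleNorm K u : ℝ) ≤ adelicHeightGL n K g ^ Module.finrank ℚ K := by
  have hH0 : 0 ≤ (GLn.archHeight n K g : ℝ) := NNReal.coe_nonneg _
  have hP1 : 1 ≤ ∏ᶠ v, (GLn.localHeight n K v g : ℝ) := GLn.one_le_finprod_localHeight g
  -- archimedean part
  have harch : ((∏ w : InfinitePlace K, ‖(u : AdeleRing (𝓞 K) K).1 w‖₊ ^ w.mult : ℝ≥0) : ℝ) ≤
      (GLn.archHeight n K g : ℝ) ^ Module.finrank ℚ K := by
    rw [NNReal.coe_prod, ← sum_mult_eq (K := K), ← Finset.prod_pow_eq_pow_sum]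
    refine Finset.prod_le_prod (fun w _ => by positivity) fun w _ => ?_
    rw [NNReal.coe_pow]
    refine pow_le_pow_left₀ (NNReal.coe_nonneg _) (NNReal.coe_le_coe.2 ?_) _
    have h := Summit.Langlands.Langlands.Theorems.GapDecayHeights.nnnorm_fst_apply_le_archHeight g i j w
    rwa [hu] at h
  -- finite part (monotonicity of `finprod` in `ℝ≥0`, then coercion)
  have hfsNN : (fun v : HeightOneSpectrum (𝓞 K) => GLn.localHeight n K v g).HasFiniteMulSupport :=
    GLn.mulSupport_localHeight_finite_holds g
  have hleNN : (∏ᶠ v : HeightOneSpectrum (𝓞 K), ‖(u : AdeleRing (𝓞 K) K).2 v‖₊) ≤ ∏ᶠ v, GLn.localHeight n K v g :=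
    finprod_le_finprod' (hasFiniteMulSupport_nnnorm K u) hfsNN fun v => by
      have h := Summit.Langlands.Langlands.Theorems.GapDecayHeights.nnnorm_snd_apply_le_localHeight g i j v
      rwa [hu] at h
  have hcoe : ((∏ᶠ v : HeightOneSpectrum (𝓞 K), GLn.localHeight n K v g : ℝ≥0) : ℝ) = ∏ᶠ v, (GLn.localHeight n K v g : ℝ) := by
    have h := map_finprod NNReal.toRealHom hfsNN
    simpa only [NNReal.coe_toRealHom] using h
  have hfin : ((∏ᶠ v : HeightOneSpectrum (𝓞 K), ‖(u : AdeleRing (𝓞 K) K).2 v‖₊ : ℝ≥0) : ℝ) ≤ ∏ᶠ v, (GLn.localHeight n K v g : ℝ) := by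
    rw [← hcoe]
    exact_mod_cast hleNN
  -- combine: `|u| ≤ H_∞^d · ∏ H_v ≤ H_∞^d · (∏ H_v)^d = ‖g‖^d`
  have hd : 1 ≤ Module.finrank ℚ K := Module.finrank_pos
  calc (IdeleClassGroup.ideleNorm K u : ℝ)
      = ((∏ w : InfinitePlace K, ‖(u : AdeleRing (𝓞 K) K).1 w‖₊ ^ w.mult : ℝ≥0) : ℝ) *
          ((∏ᶠ v : HeightOneSpectrum (𝓞 K), ‖(u : AdeleRing (𝓞 K) K).2 v‖₊ : ℝ≥0) : ℝ) := by
        rw [ideleNorm_apply, NNReal.coe_mul]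
    _ ≤ (GLn.archHeight n K g : ℝ) ^ Module.finrank ℚ K * ∏ᶠ v, (GLn.localHeight n K v g : ℝ) :=
        mul_le_mul harch hfin (NNReal.coe_nonneg _) (by positivity)
    _ ≤ (GLn.archHeight n K g : ℝ) ^ Module.finrank ℚ K * (∏ᶠ v, (GLn.localHeight n K v g : ℝ)) ^ Module.finrank ℚ K := by
        refine mul_le_mul_of_nonneg_left ?_ (by positivity)
        exact le_self_pow₀ hP1 (by omega)
    _ = adelicHeightGL n K g ^ Module.finrank ℚ K := by rw [adelicHeightGL, mul_pow]

/-- **… and for an entry of `g⁻¹`** (`‖g⁻¹‖ = ‖g‖`, ★ `adelicHeightGL_inv`). [cite: BorelJacquet1979, §1.2] -/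
theorem ideleNorm_le_adelicHeightGL_pow_of_inv_entry [NeZero n] (g : GL (Fin n) (AdeleRing (𝓞 K) K)) (i j : Fin n) (u : ideleGroup K)
    (hu : (((g⁻¹ : GL (Fin n) (AdeleRing (𝓞 K) K)) : Matrix (Fin n) (Fin n) (AdeleRing (𝓞 K) K)) i j) = (u : AdeleRing (𝓞 K) K)) :
    (IdeleClassGroup.ideleNorm K u : ℝ) ≤ adelicHeightGL n K g ^ Module.finrank ℚ K := by
  rw [← adelicHeightGL_inv]
  exact ideleNorm_le_adelicHeightGL_pow_of_entry g⁻¹ i j u hu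

/-- **Corollary for a real parameter**: if an entry of `g` (resp. `g⁻¹`) is an idèle of norm `a^{[K:ℚ]}`, then `a ≤ ‖g‖`
(no sign hypothesis on `a` is needed since `‖g‖ > 0`). [cite: MoeglinWaldspurger1995, I.2.2] -/
theorem le_adelicHeightGL_of_ideleNorm_eq_pow [NeZero n] (g : GL (Fin n) (AdeleRing (𝓞 K) K)) (i j : Fin n) (u : ideleGroup K)
    (hu : ((g : Matrix (Fin n) (Fin n) (AdeleRing (𝓞 K) K)) i j) = (u : AdeleRing (𝓞 K) K) ∨
      (((g⁻¹ : GL (Fin n) (AdeleRing (𝓞 K) K)) : Matrix (Fin n) (Fin n) (AdeleRing (𝓞 K) K)) i j) = (u : AdeleRing (𝓞 K) K))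
    {a : ℝ} (hnorm : (IdeleClassGroup.ideleNorm K u : ℝ) = a ^ Module.finrank ℚ K) :
    a ≤ adelicHeightGL n K g := by
  have hle : a ^ Module.finrank ℚ K ≤ adelicHeightGL n K g ^ Module.finrank ℚ K := by
    rw [← hnorm]
    rcases hu with hu | hu
    · exact ideleNorm_le_adelicHeightGL_pow_of_entry g i j u hu
    · exact ideleNorm_le_adelicHeightGL_pow_of_inv_entry g i j u hu
  exact le_of_pow_le_pow_left₀ Module.finrank_pos.ne' (adelicHeightGL_pos_holds g).le hle

end Summit.HodgeConjecture.HodgeConjecture.Cruxes.HLiu418.K2LiuIdeleEntryHeightBound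

end
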